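import Summits.QuantumFields.BalabanUV.Beta.RelInvSandwich
import Summits.QuantumFields.BalabanUV.Beta.SecondOrderContactResidual
import Summits.QuantumFields.BalabanUV.Beta.SecondOrderStepTransport

/-!
# `BalabanUV.Beta.SecondOrderInverseShape` — binder row D1, (L4) piece (W-E) EVALUATION, part 1: **THE SIMILARITY SHAPE PASSES TO
# THE (RELATIVE) INVERSE AT SECOND ORDER** — `K3(A; D♯, W♯) = K3(A; D, W) + conjW A (K2 b) (K2 c) X_b X_c X₂ − A∘R∘A`
# (β sub-cell, row BETA-an2 = BINDER-OWNERS row D1 OWNER, lineage an2 gen 18; design memo `SKELETON-D1-L4` v1 §3 (W-E), v2 §1)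

HONEST FRAMING (cell charter, verbatim): «discharging BetaPertH makes Balaban's UV stability UNCONDITIONAL — a real
constructive-QFT result; it is NOT the continuum limit and NOT the Clay problem.»  This module is NEUTRAL KERNEL ALGEBRA over the
RELATIVE-inverse predicate `ChartConjugationRelative.RelInv A 𝕄 E` (rules `E∘A = A`, `A∘E = A`, `(A∘𝕄)∘E = E`, `(E∘𝕄)∘A = E`) in the
tame currency of `TameKernelCalculus` ([folklore]); no statement of Bałaban's papers is typed, no `[cite:]`, no `def`, no `Prop` fact;
it instantiates no binder of the wall.  NOT D1, NOT `BetaPertH`, NOT continuum, NOT Clay.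

## What is here (all abstract: `A 𝕄 E : MKer D F` spread with `RelInv A 𝕄 E`; LETTERS `D_b D_c W R` localised; GENERATORS `X_b X_c X₂`
## localised and commuting with `E`)

Write `K2 b := −(A∘D_b)∘A` (the shape of `SecondOrderResponse.K2OfK`: the bond-derivative of the inverse) and
`K3 := −(A∘D_b)∘(K2 c) − (A∘D_c)∘(K2 b) − (A∘W)∘A` (the shape of `BalabanStepW2.K3OfK`: its second bond-derivative), and the ♯-LETTERS OF
SIMILARITY SHAPE `D♯_b := D_b + conjV 𝕄 X_b`, `W♯ := W + conjW 𝕄 D_b D_c X_b X_c X₂ + R` (first order: an5's commutator contact; second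
order: an5's nine-term contact `conjW = conjW₁ + conjW₂` of `ChartConjugation`, plus an arbitrary remainder letter `R`).

* §1 `K2_sharp_rel`: `−(A∘D♯_b)∘A = K2 b + conjV A X_b` (`RelInvSandwich.sandwich_conjV_rel`; the ♯-derivative of the inverse has the
  similarity shape of the INVERSE with the SAME generator — cf. `SecondOrderContactResidual.K2OfK_sharp_split` + `Ξ_eq_conjV_of_relInv`).
* §2 `sharp_first_factor_comp`: the product `(A∘D♯_b)∘(K2 c + conjV A X_c)` expanded into `(A∘D_b)∘(K2 c)` + eight sandwiched words
  (`sandwich_rel`, `rule_left_rel`); `sandwich_conjW₁` / `sandwich_conjW₂` / `sandwich_conjW`: `A∘(conjW 𝕄 …)∘A` expanded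
  (`sandwich_comp_X_M`, `sandwich_conjV_rel`).
* §3 **`K3_sharp_rel`** (THE THEOREM): `K3(A; D♯, W♯) = K3(A; D, W) + conjW A (K2 b) (K2 c) X_b X_c X₂ − (A∘R)∘A` — EXACT: every
  sandwiched word cancels in pairs; i.e. THE SECOND JET OF THE INVERSE INHERITS THE SIMILARITY SHAPE (with `(A, K2)` in place of
  `(𝕄, D)`, the same generators, and the remainder transported as `−A∘R∘A`).  With `E := idK` this is the familiar statement that the
  jets of `B ↦ U(B)⁻¹ 𝕄(B) U(B)` invert to those of `B ↦ U(B)⁻¹ 𝕄(B)⁻¹ U(B)`.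

WHY (row D1, hR W-side, (W-E) EVALUATION at level `j+1`, owner's statement journal l.10357): the second-order tables of the recursive wall
literal at level `j+1` are `mmRead Lc (K3OfK G_j Lc S M W b c)` (`SpineRecursiveW.e4OfKW`); their reflection law is transported by
`SecondOrderStepTransport.mmRead_K3OfK_bref_sharp` to `K3OfK` of the ♯-tables, and THIS file evaluates `K3OfK(♯) − K3OfK` in closed form;
part 2 (`mmRead` of the right-hand side = similarity shape at level `j+1` against `mmRead Lc G_j`) and the level step follow separately.
Provenance: β sub-cell, unit beta-an2 gen 18, 2026-08-20 (v1); over `TameKernelCalculus`, `ChartConjugation`, `ChartConjugationRelative`,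
`RelInvSandwich` BY NAME; no existing file touched.
-/

open Finset
open scoped BigOperators
open Literature.MathematicalPhysics.QuantumFieldTheory.Balaban1983to89
open Literature.MathematicalPhysics.QuantumFieldTheory.Balaban1983to89.Beta
open ExpKernelCalculus (MKer Decays BiLoc comp)
open OneStepResolventKernel (Fib)
open OneStepKernelFamily (colH)
open SecondOrderResponse (dM K2OfK)
open BalabanStepW2 (K3OfK)
open Summit.QuantumFields.BalabanUV.Beta.TameKernelCalculus
open Summit.QuantumFields.BalabanUV.Beta.BorderedHessian (diagK)
open Summit.QuantumFields.BalabanUV.Beta.SecondOrderTransport (K2OfK_eq)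
open Summit.QuantumFields.BalabanUV.Beta.SecondOrderContactForm (dM_table_sharp_split)
open Summit.QuantumFields.BalabanUV.Beta.ChartConjugation
open Summit.QuantumFields.BalabanUV.Beta.ChartConjugationRelative

namespace Summit.QuantumFields.BalabanUV.Beta.SecondOrderInverseShape

noncomputable section

variable {D : ℕ} {F : Type*} [Fintype F] {A M E : MKer D F}

/-! ## §1 The ♯-derivative of the inverse -/

/-- [folklore] **THE ♯-DERIVATIVE OF THE (RELATIVE) INVERSE HAS THE SIMILARITY SHAPE OF THE INVERSE**:
`−(A∘(D + conjV 𝕄 X))∘A = −(A∘D)∘A + conjV A X`. -/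
theorem K2_sharp_rel (hA : Spr A) (hM : Spr M) (hE : Spr E) (hR : RelInv A M E) {Dl X : MKer D F} (hD : Loc Dl) (hX : Loc X)
    (hEX : comp E X = comp X E) :
    -(comp (comp A (Dl + conjV M X)) A) = -(comp (comp A Dl) A) + conjV A X := by
  have hcV : Loc (conjV M X) := loc_conjV hM hX
  rw [comp_add_right_tame hA.tame hD.tame hcV.tame, comp_add_left_tame (hA.comp_loc hD).tame (hA.comp_loc hcV).tame hA.tame,
    sandwich_conjV_rel hA hM hE hR hX hEX, neg_add, neg_neg]

/-! ## §2 The sandwiched words -/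

section Words

variable (hA : Spr A) (hM : Spr M) (hE : Spr E) (hR : RelInv A M E)
include hA hM hE hR

/-- [folklore] `(A∘conjV 𝕄 X)∘((A∘D)∘A) = X∘((A∘D)∘A) − ((A∘X)∘D)∘A` (`sandwich_rel` with `Z := D∘A`). -/
theorem sandwich_K2 {X Dl : MKer D F} (hX : Loc X) (hD : Loc Dl) (hEX : comp E X = comp X E) :
    comp (comp A (conjV M X)) (comp (comp A Dl) A) = comp X (comp (comp A Dl) A) - comp (comp (comp A X) Dl) A := by
  rw [← comp_assoc_tame hA.tame hD.tame hA.tame, sandwich_rel hA hM hE hR hX (hD.comp_spr hA) hEX,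
    comp_assoc_tame (hA.comp_loc hX).tame hD.tame hA.tame]

/-- [folklore] `(A∘conjV 𝕄 X)∘(X′∘A) = (X∘X′)∘A − ((A∘X)∘(𝕄∘X′))∘A` (`rule_left_rel` with the letter `X∘X′`). -/
theorem sandwich_XA {X Xp : MKer D F} (hX : Loc X) (hXp : Loc Xp) (hEX : comp E X = comp X E) (hEXp : comp E Xp = comp Xp E) :
    comp (comp A (conjV M X)) (comp Xp A) = comp (comp X Xp) A - comp (comp (comp A X) (comp M Xp)) A := by
  have hXpA : Loc (comp Xp A) := hXp.comp_spr hA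
  have hAM : Tame (comp A M) := (spr_comp hA hM).tame
  have hEXX : comp E (comp X Xp) = comp (comp X Xp) E := comm_comp hE hX hXp hEX hEXp
  have t1 : comp (comp A (comp M X)) (comp Xp A) = comp (comp X Xp) A :=
    calc comp (comp A (comp M X)) (comp Xp A) = comp (comp (comp A M) X) (comp Xp A) := by rw [comp_assoc_tame hA.tame hM.tame hX.tame]
      _ = comp (comp A M) (comp X (comp Xp A)) := (comp_assoc_tame hAM hX.tame hXpA.tame).symm
      _ = comp (comp A M) (comp (comp X Xp) A) := by rw [comp_assoc_tame hX.tame hXp.tame hA.tame]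
      _ = comp (comp X Xp) A := rule_left_rel hA hM hE hR (hX.comp hXp) hEXX
  have t2 : comp (comp A (comp X M)) (comp Xp A) = comp (comp (comp A X) (comp M Xp)) A :=
    calc comp (comp A (comp X M)) (comp Xp A) = comp (comp (comp A X) M) (comp Xp A) := by rw [comp_assoc_tame hA.tame hX.tame hM.tame]
      _ = comp (comp A X) (comp M (comp Xp A)) := (comp_assoc_tame (hA.comp_loc hX).tame hM.tame hXpA.tame).symm
      _ = comp (comp A X) (comp (comp M Xp) A) := by rw [comp_assoc_tame hM.tame hXp.tame hA.tame]
      _ = comp (comp (comp A X) (comp M Xp)) A := comp_assoc_tame (hA.comp_loc hX).tame (hM.comp_loc hXp).tame hA.tame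
  unfold conjV
  rw [comp_sub_right_tame hA.tame (hM.comp_loc hX).tame (hX.comp_spr hM).tame,
    comp_sub_left_tame (hA.comp_loc (hM.comp_loc hX)).tame (hA.comp_loc (hX.comp_spr hM)).tame hXpA.tame, t1, t2]

/-- [folklore] **THE ♯-FIRST FACTOR AGAINST THE ♯-DERIVATIVE OF THE INVERSE**, expanded:
`(A∘(D_b + conjV 𝕄 X_b))∘(−(A∘D_c)∘A + conjV A X_c) = (A∘D_b)∘(−(A∘D_c)∘A)` + eight sandwiched words. -/
theorem sharp_first_factor_comp {Db Dc Xb Xc : MKer D F} (hDb : Loc Db) (hDc : Loc Dc) (hXb : Loc Xb) (hXc : Loc Xc)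
    (hEXb : comp E Xb = comp Xb E) (hEXc : comp E Xc = comp Xc E) :
    comp (comp A (Db + conjV M Xb)) (-(comp (comp A Dc) A) + conjV A Xc) =
      comp (comp A Db) (-(comp (comp A Dc) A))
      + (comp (comp (comp A Db) A) Xc - comp (comp (comp A Db) Xc) A)
      + (-(comp Xb (comp (comp A Dc) A)) + comp (comp (comp A Xb) Dc) A)
      + (comp Xb (comp A Xc) - comp (comp A Xb) Xc - comp (comp Xb Xc) A + comp (comp (comp A Xb) (comp M Xc)) A) := by
  have hcVb : Loc (conjV M Xb) := loc_conjV hM hXb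
  have hcAc : Loc (conjV A Xc) := loc_conjV hA hXc
  have hP : Loc (comp A Db) := hA.comp_loc hDb
  have hQ : Loc (comp A (conjV M Xb)) := hA.comp_loc hcVb
  have hK2c : Loc (comp (comp A Dc) A) := (hA.comp_loc hDc).comp_spr hA
  -- (i) the plain first factor against the commutator
  have e1 : comp (comp A Db) (conjV A Xc) = comp (comp (comp A Db) A) Xc - comp (comp (comp A Db) Xc) A := by
    unfold conjV
    rw [comp_sub_right_tame hP.tame (hA.comp_loc hXc).tame (hXc.comp_spr hA).tame, comp_assoc_tame hP.tame hA.tame hXc.tame,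
      comp_assoc_tame hP.tame hXc.tame hA.tame]
  -- (ii) the contact factor against the plain derivative of the inverse
  have e2 : comp (comp A (conjV M Xb)) (-(comp (comp A Dc) A)) = -(comp Xb (comp (comp A Dc) A)) + comp (comp (comp A Xb) Dc) A := by
    rw [comp_neg_right, sandwich_K2 hA hM hE hR hXb hDc hEXb, neg_sub, sub_eq_neg_add]
  -- (iii) the contact factor against the commutator
  have e3 : comp (comp A (conjV M Xb)) (conjV A Xc) =
      comp Xb (comp A Xc) - comp (comp A Xb) Xc - comp (comp Xb Xc) A + comp (comp (comp A Xb) (comp M Xc)) A := by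
    have h1 : comp (comp A (conjV M Xb)) (comp A Xc) = comp Xb (comp A Xc) - comp (comp A Xb) Xc := sandwich_rel hA hM hE hR hXb hXc hEXb
    have hc : conjV A Xc = comp A Xc - comp Xc A := rfl
    rw [hc, comp_sub_right_tame hQ.tame (hA.comp_loc hXc).tame (hXc.comp_spr hA).tame, h1, sandwich_XA hA hM hE hR hXb hXc hEXb hEXc]
    abel
  rw [comp_add_right_tame hA.tame hDb.tame hcVb.tame, comp_add_left_tame hP.tame hQ.tame (hK2c.neg.add hcAc).tame,
    comp_add_right_tame hP.tame hK2c.neg.tame hcAc.tame, comp_add_right_tame hQ.tame hK2c.neg.tame hcAc.tame, e1, e2, e3]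
  abel


omit hM hE hR in
/-- [folklore] **THE SANDWICH OF THE FIRST-ORDER PIECE `conjW₁`**: `A∘(conjW₁ D_b D_c X_b X_c)∘A` = four sandwiched words (plain
bilinearity and re-association; no inverse rule is used). -/
theorem sandwich_conjW₁ {Db Dc Xb Xc : MKer D F} (hDb : Loc Db) (hDc : Loc Dc) (hXb : Loc Xb) (hXc : Loc Xc) :
    comp (comp A (conjW₁ Db Dc Xb Xc)) A =
      comp (comp (comp A Dc) Xb) A - comp (comp (comp A Xb) Dc) A + (comp (comp (comp A Db) Xc) A - comp (comp (comp A Xc) Db) A) := by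
  have h1 : Loc (comp Dc Xb) := hDc.comp hXb
  have h2 : Loc (comp Xb Dc) := hXb.comp hDc
  have h3 : Loc (comp Db Xc) := hDb.comp hXc
  have h4 : Loc (comp Xc Db) := hXc.comp hDb
  unfold conjW₁
  rw [comp_add_right_tame hA.tame (h1.sub h2).tame (h3.sub h4).tame, comp_sub_right_tame hA.tame h1.tame h2.tame,
    comp_sub_right_tame hA.tame h3.tame h4.tame,
    comp_add_left_tame ((hA.comp_loc h1).sub (hA.comp_loc h2)).tame ((hA.comp_loc h3).sub (hA.comp_loc h4)).tame hA.tame,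
    comp_sub_left_tame (hA.comp_loc h1).tame (hA.comp_loc h2).tame hA.tame, comp_sub_left_tame (hA.comp_loc h3).tame (hA.comp_loc h4).tame hA.tame,
    comp_assoc_tame hA.tame hDc.tame hXb.tame, comp_assoc_tame hA.tame hXb.tame hDc.tame, comp_assoc_tame hA.tame hDb.tame hXc.tame,
    comp_assoc_tame hA.tame hXc.tame hDb.tame]

/-- [folklore] **THE SANDWICH OF THE QUADRATIC PIECE `conjW₂`**: `A∘(conjW₂ 𝕄 X_b X_c X₂)∘A = A∘(X_bX_c) + A∘(X_cX_b) − ((A∘X_b)∘(𝕄∘X_c))∘A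
− ((A∘X_c)∘(𝕄∘X_b))∘A − conjV A X₂` (`sandwich_comp_X_M` with the letter `X∘X′`, `sandwich_conjV_rel`). -/
theorem sandwich_conjW₂ {Xb Xc X₂ : MKer D F} (hXb : Loc Xb) (hXc : Loc Xc) (hX₂ : Loc X₂) (hEXb : comp E Xb = comp Xb E)
    (hEXc : comp E Xc = comp Xc E) (hEX₂ : comp E X₂ = comp X₂ E) :
    comp (comp A (conjW₂ M Xb Xc X₂)) A =
      comp A (comp Xb Xc) + comp A (comp Xc Xb) - (comp (comp (comp A Xb) (comp M Xc)) A + comp (comp (comp A Xc) (comp M Xb)) A)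
        - conjV A X₂ := by
  have hbc : Loc (comp Xb Xc) := hXb.comp hXc
  have hcb : Loc (comp Xc Xb) := hXc.comp hXb
  have hP : Loc (comp (comp Xb Xc) M + comp (comp Xc Xb) M) := (hbc.comp_spr hM).add (hcb.comp_spr hM)
  have hQ : Loc (comp (comp Xb M) Xc + comp (comp Xc M) Xb) := ((hXb.comp_spr hM).comp hXc).add ((hXc.comp_spr hM).comp hXb)
  have hRr : Loc (comp M X₂ - comp X₂ M) := (hM.comp_loc hX₂).sub (hX₂.comp_spr hM)
  have ea : comp (comp A (comp (comp Xb Xc) M)) A = comp A (comp Xb Xc) :=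
    sandwich_comp_X_M hA hM hE hR hbc (comm_comp hE hXb hXc hEXb hEXc)
  have ea' : comp (comp A (comp (comp Xc Xb) M)) A = comp A (comp Xc Xb) :=
    sandwich_comp_X_M hA hM hE hR hcb (comm_comp hE hXc hXb hEXc hEXb)
  have eb : comp (comp A (comp (comp Xb M) Xc)) A = comp (comp (comp A Xb) (comp M Xc)) A := by
    rw [comp_assoc_tame hA.tame (hXb.comp_spr hM).tame hXc.tame, comp_assoc_tame hA.tame hXb.tame hM.tame,
      ← comp_assoc_tame (hA.comp_loc hXb).tame hM.tame hXc.tame]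
  have eb' : comp (comp A (comp (comp Xc M) Xb)) A = comp (comp (comp A Xc) (comp M Xb)) A := by
    rw [comp_assoc_tame hA.tame (hXc.comp_spr hM).tame hXb.tame, comp_assoc_tame hA.tame hXc.tame hM.tame,
      ← comp_assoc_tame (hA.comp_loc hXc).tame hM.tame hXb.tame]
  have ec : comp (comp A (comp M X₂ - comp X₂ M)) A = -conjV A X₂ := sandwich_conjV_rel hA hM hE hR hX₂ hEX₂
  unfold conjW₂
  rw [comp_add_right_tame hA.tame (hP.sub hQ).tame hRr.tame, comp_sub_right_tame hA.tame hP.tame hQ.tame,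
    comp_add_right_tame hA.tame (hbc.comp_spr hM).tame (hcb.comp_spr hM).tame,
    comp_add_right_tame hA.tame ((hXb.comp_spr hM).comp hXc).tame ((hXc.comp_spr hM).comp hXb).tame,
    comp_add_left_tame (((hA.comp_loc (hbc.comp_spr hM)).add (hA.comp_loc (hcb.comp_spr hM))).sub
      ((hA.comp_loc ((hXb.comp_spr hM).comp hXc)).add (hA.comp_loc ((hXc.comp_spr hM).comp hXb)))).tame (hA.comp_loc hRr).tame hA.tame,
    comp_sub_left_tame ((hA.comp_loc (hbc.comp_spr hM)).add (hA.comp_loc (hcb.comp_spr hM))).tame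
      ((hA.comp_loc ((hXb.comp_spr hM).comp hXc)).add (hA.comp_loc ((hXc.comp_spr hM).comp hXb))).tame hA.tame,
    comp_add_left_tame (hA.comp_loc (hbc.comp_spr hM)).tame (hA.comp_loc (hcb.comp_spr hM)).tame hA.tame,
    comp_add_left_tame (hA.comp_loc ((hXb.comp_spr hM).comp hXc)).tame (hA.comp_loc ((hXc.comp_spr hM).comp hXb)).tame hA.tame,
    ea, ea', eb, eb', ec]
  abel

/-- [folklore] **THE SANDWICH OF THE FULL SECOND-ORDER CONTACT** `A∘(conjW 𝕄 D_b D_c X_b X_c X₂)∘A`, expanded. -/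
theorem sandwich_conjW {Db Dc Xb Xc X₂ : MKer D F} (hDb : Loc Db) (hDc : Loc Dc) (hXb : Loc Xb) (hXc : Loc Xc) (hX₂ : Loc X₂)
    (hEXb : comp E Xb = comp Xb E) (hEXc : comp E Xc = comp Xc E) (hEX₂ : comp E X₂ = comp X₂ E) :
    comp (comp A (conjW M Db Dc Xb Xc X₂)) A =
      comp (comp (comp A Dc) Xb) A - comp (comp (comp A Xb) Dc) A + (comp (comp (comp A Db) Xc) A - comp (comp (comp A Xc) Db) A)
      + (comp A (comp Xb Xc) + comp A (comp Xc Xb) - (comp (comp (comp A Xb) (comp M Xc)) A + comp (comp (comp A Xc) (comp M Xb)) A)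
        - conjV A X₂) := by
  have h1 : Loc (conjW₁ Db Dc Xb Xc) := loc_conjW₁ hDb hDc hXb hXc
  have h2 : Loc (conjW₂ M Xb Xc X₂) := loc_conjW₂ hM hXb hXc hX₂
  unfold conjW
  rw [comp_add_right_tame hA.tame h1.tame h2.tame, comp_add_left_tame (hA.comp_loc h1).tame (hA.comp_loc h2).tame hA.tame,
    sandwich_conjW₁ hA hDb hDc hXb hXc, sandwich_conjW₂ hA hM hE hR hXb hXc hX₂ hEXb hEXc hEX₂]

end Words

/-! ## §3 The theorem: the second jet of the inverse inherits the similarity shape -/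

/-- [folklore] **THE SIMILARITY SHAPE PASSES TO THE (RELATIVE) INVERSE AT SECOND ORDER.**  For spread `A`, `𝕄`, `E` with
`RelInv A 𝕄 E`, localised letters `D_b, D_c, W, R` and localised generators `X_b, X_c, X₂` commuting with `E`:
`K3(A; D♯, W♯) = K3(A; D, W) + conjW A (K2 b) (K2 c) X_b X_c X₂ − (A∘R)∘A`, where `K2 b := −(A∘D_b)∘A`,
`K3(A; D, W) := −(A∘D_b)∘(K2 c) − (A∘D_c)∘(K2 b) − (A∘W)∘A`, `D♯_b := D_b + conjV 𝕄 X_b`, `W♯ := W + conjW 𝕄 D_b D_c X_b X_c X₂ + R`.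
EXACT — no remainder is generated by the inversion itself. -/
theorem K3_sharp_rel (hA : Spr A) (hM : Spr M) (hE : Spr E) (hR : RelInv A M E) {Db Dc W R Xb Xc X₂ : MKer D F}
    (hDb : Loc Db) (hDc : Loc Dc) (hW : Loc W) (hRm : Loc R) (hXb : Loc Xb) (hXc : Loc Xc) (hX₂ : Loc X₂)
    (hEXb : comp E Xb = comp Xb E) (hEXc : comp E Xc = comp Xc E) (hEX₂ : comp E X₂ = comp X₂ E) :
    -(comp (comp A (Db + conjV M Xb)) (-(comp (comp A (Dc + conjV M Xc)) A)))
      - comp (comp A (Dc + conjV M Xc)) (-(comp (comp A (Db + conjV M Xb)) A))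
      - comp (comp A (W + conjW M Db Dc Xb Xc X₂ + R)) A =
    (-(comp (comp A Db) (-(comp (comp A Dc) A))) - comp (comp A Dc) (-(comp (comp A Db) A)) - comp (comp A W) A)
      + conjW A (-(comp (comp A Db) A)) (-(comp (comp A Dc) A)) Xb Xc X₂ - comp (comp A R) A := by
  have hcW : Loc (conjW M Db Dc Xb Xc X₂) := loc_conjW hM hDb hDc hXb hXc hX₂
  rw [K2_sharp_rel hA hM hE hR hDc hXc hEXc, K2_sharp_rel hA hM hE hR hDb hXb hEXb,
    sharp_first_factor_comp hA hM hE hR hDb hDc hXb hXc hEXb hEXc, sharp_first_factor_comp hA hM hE hR hDc hDb hXc hXb hEXc hEXb,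
    comp_add_right_tame hA.tame (hW.add hcW).tame hRm.tame, comp_add_right_tame hA.tame hW.tame hcW.tame,
    comp_add_left_tame ((hA.comp_loc hW).add (hA.comp_loc hcW)).tame (hA.comp_loc hRm).tame hA.tame,
    comp_add_left_tame (hA.comp_loc hW).tame (hA.comp_loc hcW).tame hA.tame,
    sandwich_conjW hA hM hE hR hDb hDc hXb hXc hX₂ hEXb hEXc hEX₂,
    ← comp_assoc_tame hA.tame hXb.tame hXc.tame, ← comp_assoc_tame hA.tame hXc.tame hXb.tame,
    comp_assoc_tame hXb.tame hA.tame hXc.tame, comp_assoc_tame hXc.tame hA.tame hXb.tame]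
  unfold conjW conjW₁ conjW₂ conjV
  simp only [comp_neg_left, comp_neg_right]
  abel


/-! ## §4 The instantiation: `K3OfK` of the ♯-tables of similarity shape -/

section Tables

variable {d N : ℕ}

/-- [folklore] **`K3OfK` OF THE ♯-TABLES, IN CLOSED FORM.**  For a spread packed kernel `K` with `RelInv K 𝕄 E` (`𝕄`, `E` spread), first-order
tables `S`, `M` with the diagonal-contact ♯-table `S♯ κ u := S κ u + conjV 𝕄 (diagK (g κ u))` (`M♯ := M`), and a second-order table whose
♯-bi-table is of SIMILARITY SHAPE UP TO A REMAINDER,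
`W♯ b c := W b c + conjW 𝕄 (dM K N S M b) (dM K N S M c) (diagK (G b)) (diagK (G c)) (X₂ b c) + R b c` (`G b` = `g` dressed by `colH K N b`):
`K3OfK K N S♯ M W♯ b c = K3OfK K N S M W b c + conjW K (K2OfK K N S M b) (K2OfK K N S M c) (diagK (G b)) (diagK (G c)) (X₂ b c) − K∘(R b c)∘K`
(`dM_table_sharp_split` + `K3_sharp_rel`).  Entrywise column summabilities, localisations and the `E`-commutations are the only hypotheses. -/
theorem K3OfK_sharp_split {K 𝕄 E : MKer (d + 1) (Fib d)} (hKs : Spr K) (h𝕄 : Spr 𝕄) (hE : Spr E) (hR : RelInv K 𝕄 E)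
    {S M : Fin (d + 1) → (Fin (d + 1) → ℤ) → MKer (d + 1) (Fib d)}
    {g : Fin (d + 1) → (Fin (d + 1) → ℤ) → (Fin (d + 1) → ℤ) → Fib d → ℝ}
    {W R X₂ : Fin (d + 1) → (Fin (d + 1) → ℤ) → Fin (d + 1) → (Fin (d + 1) → ℤ) → MKer (d + 1) (Fib d)}
    (μ : Fin (d + 1)) (y : Fin (d + 1) → ℤ) (ν : Fin (d + 1)) (y' : Fin (d + 1) → ℤ)
    (hS : ∀ (μ : Fin (d + 1)) (y : Fin (d + 1) → ℤ) (κ : Fin (d + 1)) (x z : Fin (d + 1) → ℤ) (a b : Fib d),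
      Summable fun u => colH K N μ y κ u * S κ u x z a b)
    (hg : ∀ (μ : Fin (d + 1)) (y : Fin (d + 1) → ℤ) (κ : Fin (d + 1)) (p : Fin (d + 1) → ℤ) (c : Fib d),
      Summable fun u => colH K N μ y κ u * g κ u p c)
    (hDb : Loc (dM K N S M μ y)) (hDc : Loc (dM K N S M ν y')) (hW : Loc (W μ y ν y')) (hRm : Loc (R μ y ν y'))
    (hGb : Loc (diagK fun p c => ∑ κ, ∑' u, colH K N μ y κ u * g κ u p c))
    (hGc : Loc (diagK fun p c => ∑ κ, ∑' u, colH K N ν y' κ u * g κ u p c)) (hX₂ : Loc (X₂ μ y ν y'))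
    (hEGb : comp E (diagK fun p c => ∑ κ, ∑' u, colH K N μ y κ u * g κ u p c) = comp (diagK fun p c => ∑ κ, ∑' u, colH K N μ y κ u * g κ u p c) E)
    (hEGc : comp E (diagK fun p c => ∑ κ, ∑' u, colH K N ν y' κ u * g κ u p c) = comp (diagK fun p c => ∑ κ, ∑' u, colH K N ν y' κ u * g κ u p c) E)
    (hEX₂ : comp E (X₂ μ y ν y') = comp (X₂ μ y ν y') E) :
    K3OfK K N (fun κ u => S κ u + conjV 𝕄 (diagK (g κ u))) M
        (fun μ y ν y' => W μ y ν y' +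
          conjW 𝕄 (dM K N S M μ y) (dM K N S M ν y') (diagK fun p c => ∑ κ, ∑' u, colH K N μ y κ u * g κ u p c)
            (diagK fun p c => ∑ κ, ∑' u, colH K N ν y' κ u * g κ u p c) (X₂ μ y ν y') + R μ y ν y') μ y ν y' =
      K3OfK K N S M W μ y ν y' +
        conjW K (K2OfK K N S M μ y) (K2OfK K N S M ν y') (diagK fun p c => ∑ κ, ∑' u, colH K N μ y κ u * g κ u p c)
          (diagK fun p c => ∑ κ, ∑' u, colH K N ν y' κ u * g κ u p c) (X₂ μ y ν y') - comp (comp K (R μ y ν y')) K := by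
  have eL : K3OfK K N (fun κ u => S κ u + conjV 𝕄 (diagK (g κ u))) M
        (fun μ y ν y' => W μ y ν y' +
          conjW 𝕄 (dM K N S M μ y) (dM K N S M ν y') (diagK fun p c => ∑ κ, ∑' u, colH K N μ y κ u * g κ u p c)
            (diagK fun p c => ∑ κ, ∑' u, colH K N ν y' κ u * g κ u p c) (X₂ μ y ν y') + R μ y ν y') μ y ν y' =
      -(comp (comp K (dM K N (fun κ u => S κ u + conjV 𝕄 (diagK (g κ u))) M μ y))
          (K2OfK K N (fun κ u => S κ u + conjV 𝕄 (diagK (g κ u))) M ν y')) -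
        comp (comp K (dM K N (fun κ u => S κ u + conjV 𝕄 (diagK (g κ u))) M ν y'))
          (K2OfK K N (fun κ u => S κ u + conjV 𝕄 (diagK (g κ u))) M μ y) -
        comp (comp K (W μ y ν y' +
          conjW 𝕄 (dM K N S M μ y) (dM K N S M ν y') (diagK fun p c => ∑ κ, ∑' u, colH K N μ y κ u * g κ u p c)
            (diagK fun p c => ∑ κ, ∑' u, colH K N ν y' κ u * g κ u p c) (X₂ μ y ν y') + R μ y ν y')) K := by
    funext x z a b; rfl
  have eR : K3OfK K N S M W μ y ν y' =
      -(comp (comp K (dM K N S M μ y)) (K2OfK K N S M ν y')) - comp (comp K (dM K N S M ν y')) (K2OfK K N S M μ y) -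
        comp (comp K (W μ y ν y')) K := by
    funext x z a b; rfl
  rw [eL, eR, K2OfK_eq, K2OfK_eq, K2OfK_eq, K2OfK_eq, dM_table_sharp_split N 𝕄 K S M μ y (hS μ y) hg,
    dM_table_sharp_split N 𝕄 K S M ν y' (hS ν y') hg]
  exact K3_sharp_rel hKs h𝕄 hE hR hDb hDc hW hRm hGb hGc hX₂ hEGb hEGc hEX₂

end Tables

end

end Summit.QuantumFields.BalabanUV.Beta.SecondOrderInverseShape
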